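import Literature.NumberTheory.LFunctions.TwistedDedekindCoefficients
import Mathlib.NumberTheory.EulerProduct.Basic
import HarnessLib

/-!
# Euler product over the rational primes of the twisted `L`-series `Σ ν(I) N(I)^{-s}` of a number field

Helper file for the crux `PeterssonLowerBound` (stmt-ABC-10870), stub `stub_j0` (the CM family
`j = 0`): the comparison `L(Sym² f_E, σ) = L(σ, χ₋₃) · L(σ, ν_E) · E(σ)` is made prime by prime over
the RATIONAL primes, so we need `L(s, ν) = ∏_p Σ_e a_ν(p^e) p^{-es}` for the Dirichlet series
`L(s, ν) = Σ_n a_ν(n) n^{-s}`, `a_ν(n) = twistCount K ν n = Σ_{N(I) = n} ν(I)`, of a completely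
multiplicative `ν : Ideal(𝓞 K) →*₀ ℂ` with `|ν| ≤ 1` (`TwistedDedekindCoefficients`). Everything here is
proved:

* `twistCount_mul_of_coprime` — `a_ν(mn) = a_ν(m) a_ν(n)` for coprime `m, n` (the bijection
  `I ↦ (I + (m), I + (n))` of `IdealNormCount.equivProdOfCoprime`);
* `hasProd_term_twistCount` — **`∏_p (Σ_e a_ν(p^e) (p^e)^{-s}) = L(s, ν)`** for `Re s > 1`
  (Mathlib's `EulerProduct.eulerProduct_hasProd`);
* `twistCount_prime_pow_eq_zero_of_dvd`, `tsum_term_twistCount_prime_pow_eq_one` — if `ν` vanishes on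
  the ideals not coprime to `(M)` then `a_ν(p^e) = 0` for `p ∣ M`, `e ≥ 1`, so the local factor at
  `p ∣ M` is `1`.

References: standard (Hecke 1920; Narkiewicz, *Elementary and Analytic Theory of Algebraic Numbers*,
Ch. 7 §1). [folklore]
-/

noncomputable section

set_option linter.dupNamespace false

open Complex Finset Filter Topology NumberField
open scoped LSeries.notation
open Literature.NumberTheory.LFunctions Literature.NumberTheory.LFunctions.NumberField

namespace Summit.ABC.ABC.Theorems.PeterssonJ0

variable (K : Type*) [Field K] [NumberField K] (ν : Ideal (𝓞 K) →*₀ ℂ)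

/-! ### Multiplicativity of `a_ν(n) = Σ_{N(I)=n} ν(I)` on coprime arguments -/

/-- `a_ν(n)` as a sum over the subtype of ideals of norm `n` (for any `Fintype` structure on it).
[folklore] -/
theorem twistCount_eq_sum_subtype (n : ℕ) [Fintype {I : Ideal (𝓞 K) // Ideal.absNorm I = n}] :
    twistCount K ν n = ∑ I : {I : Ideal (𝓞 K) // Ideal.absNorm I = n}, ν I.1 := by
  rw [twistCount]
  exact Finset.sum_subtype (idealsOfNorm K n) (fun _ ↦ mem_idealsOfNorm) _

/-- **`a_ν(mn) = a_ν(m) a_ν(n)` for coprime `m, n`** (complete multiplicativity of `ν` on ideals and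
the bijection `{N(I) = mn} ≃ {N(A) = m} × {N(B) = n}`, `I ↦ (I + (m), I + (n))`, `(A, B) ↦ AB`).
[folklore] -/
theorem twistCount_mul_of_coprime {m n : ℕ} (h : m.Coprime n) :
    twistCount K ν (m * n) = twistCount K ν m * twistCount K ν n := by
  rcases Nat.eq_zero_or_pos m with rfl | hm
  · have hn : n = 1 := by simpa using h
    subst hn
    simp [twistCount_one, twistCount_zero]
  rcases Nat.eq_zero_or_pos n with rfl | hn
  · have hm1 : m = 1 := by simpa using h
    subst hm1
    simp [twistCount_one, twistCount_zero]
  letI : Fintype {I : Ideal (𝓞 K) // Ideal.absNorm I = m * n} :=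
    Fintype.ofFinset (idealsOfNorm K (m * n)) (fun _ ↦ mem_idealsOfNorm)
  letI : Fintype {I : Ideal (𝓞 K) // Ideal.absNorm I = m} := Fintype.ofFinset (idealsOfNorm K m) (fun _ ↦ mem_idealsOfNorm)
  letI : Fintype {I : Ideal (𝓞 K) // Ideal.absNorm I = n} := Fintype.ofFinset (idealsOfNorm K n) (fun _ ↦ mem_idealsOfNorm)
  rw [twistCount_eq_sum_subtype K ν (m * n), twistCount_eq_sum_subtype K ν m,
    twistCount_eq_sum_subtype K ν n, Finset.sum_mul_sum, ← Fintype.sum_prod_type']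
  symm
  refine Fintype.sum_equiv (IdealNormCount.equivProdOfCoprime K hm hn h).symm
    (fun AB ↦ ν AB.1.1 * ν AB.2.1) (fun I ↦ ν I.1) fun AB ↦ ?_
  rw [← map_mul]
  rfl

/-! ### The Euler product over the rational primes -/

/-- The `L`-series term of `a_ν` is multiplicative on coprime arguments. [folklore] -/
theorem term_twistCount_mul_of_coprime (s : ℂ) {m n : ℕ} (h : m.Coprime n) :
    LSeries.term (twistCount K ν) s (m * n) =
      LSeries.term (twistCount K ν) s m * LSeries.term (twistCount K ν) s n := by
  rcases Nat.eq_zero_or_pos m with rfl | hm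
  · simp [LSeries.term_zero]
  rcases Nat.eq_zero_or_pos n with rfl | hn
  · simp [LSeries.term_zero]
  rw [LSeries.term_of_ne_zero (Nat.mul_ne_zero hm.ne' hn.ne'), LSeries.term_of_ne_zero hm.ne',
    LSeries.term_of_ne_zero hn.ne', twistCount_mul_of_coprime K ν h, Nat.cast_mul,
    Complex.natCast_mul_natCast_cpow]
  have hm0 : (m : ℂ) ^ s ≠ 0 := by
    rw [Ne, cpow_eq_zero_iff, not_and_or]; exact Or.inl (by exact_mod_cast hm.ne')
  have hn0 : (n : ℂ) ^ s ≠ 0 := by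
    rw [Ne, cpow_eq_zero_iff, not_and_or]; exact Or.inl (by exact_mod_cast hn.ne')
  field_simp

/-- **The Euler product of `L(s, ν)` over the rational primes**: for `Re s > 1`,
`∏_p (Σ_{e ≥ 0} a_ν(p^e) (p^e)^{-s}) = L(s, ν)` (as a `HasProd` over `Nat.Primes`).
[folklore] -/
theorem hasProd_term_twistCount (hν : ∀ I, ‖ν I‖ ≤ 1) {s : ℂ} (hs : 1 < s.re) :
    HasProd (fun p : Nat.Primes ↦ ∑' e : ℕ, LSeries.term (twistCount K ν) s ((p : ℕ) ^ e))
      (LSeries (twistCount K ν) s) := by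
  have h1 : LSeries.term (twistCount K ν) s 1 = 1 := by
    rw [LSeries.term_of_ne_zero one_ne_zero, twistCount_one]; simp
  have hsum : Summable fun n ↦ ‖LSeries.term (twistCount K ν) s n‖ :=
    (LSeriesSummable_twistCount hν hs).norm
  exact EulerProduct.eulerProduct_hasProd h1 (fun hmn ↦ term_twistCount_mul_of_coprime K ν s hmn) hsum
    (LSeries.term_zero _ _)

/-- The same as convergence of the partial products over `p < n`. [folklore] -/
theorem tendsto_prod_primesBelow_tsum_term_twistCount (hν : ∀ I, ‖ν I‖ ≤ 1) {s : ℂ} (hs : 1 < s.re) :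
    Tendsto (fun n : ℕ ↦ ∏ p ∈ Nat.primesBelow n, ∑' e : ℕ, LSeries.term (twistCount K ν) s (p ^ e))
      atTop (𝓝 (LSeries (twistCount K ν) s)) := by
  have h := hasProd_term_twistCount K ν hν hs
  have h' : HasProd (Set.mulIndicator {p | Nat.Prime p}
      (fun p : ℕ ↦ ∑' e : ℕ, LSeries.term (twistCount K ν) s (p ^ e))) (LSeries (twistCount K ν) s) := by
    rw [← hasProd_subtype_iff_mulIndicator]
    exact h
  have H (n : ℕ) : ∏ i ∈ Finset.range n, Set.mulIndicator {p | Nat.Prime p}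
      (fun p : ℕ ↦ ∑' e : ℕ, LSeries.term (twistCount K ν) s (p ^ e)) i =
      ∏ p ∈ Nat.primesBelow n, ∑' e : ℕ, LSeries.term (twistCount K ν) s (p ^ e) :=
    Finset.prod_mulIndicator_eq_prod_filter (Finset.range n) (fun _ ↦ _) (fun _ ↦ {p | Nat.Prime p}) id
  simpa only [H] using h'.tendsto_prod_nat

/-! ### The local factor at the primes where `ν` is trivialised -/

/-- An ideal of norm `p^e`, `e ≥ 1`, is not coprime to `(M)` when `p ∣ M`. [folklore] -/
theorem not_isCoprime_span_of_absNorm_eq {p e M : ℕ} (hp : p.Prime) (he : 1 ≤ e) (hpM : p ∣ M)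
    {I : Ideal (𝓞 K)} (hI : Ideal.absNorm I = p ^ e) :
    ¬ IsCoprime I (Ideal.span {(M : 𝓞 K)}) := by
  intro hco
  -- coprime to `(M)` ⟹ coprime to `(p)` ⟹ coprime to `(p^e) ⊆ I` ⟹ `I = ⊤`
  have hle : Ideal.span {(M : 𝓞 K)} ≤ Ideal.span {(p : 𝓞 K)} := by
    obtain ⟨c, rfl⟩ := hpM
    refine Ideal.span_singleton_le_span_singleton.mpr ⟨(c : 𝓞 K), by push_cast; ring⟩
  have hco' : IsCoprime I (Ideal.span {(p : 𝓞 K)}) := by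
    rw [Ideal.isCoprime_iff_sup_eq] at hco ⊢
    exact top_le_iff.mp (hco ▸ sup_le_sup_left hle I)
  have hco'' : IsCoprime I (Ideal.span {((p ^ e : ℕ) : 𝓞 K)}) := by
    have := hco'.pow_right (n := e)
    rwa [Ideal.span_singleton_pow, ← Nat.cast_pow] at this
  have hmem : ((p ^ e : ℕ) : 𝓞 K) ∈ I := by rw [← hI]; exact Ideal.absNorm_mem I
  have hItop : I = ⊤ := by
    rw [Ideal.isCoprime_iff_sup_eq, sup_eq_left.mpr ((Ideal.span_singleton_le_iff_mem _).mpr hmem)] at hco''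
    exact hco''
  rw [hItop, Ideal.absNorm_top] at hI
  have : 1 < p ^ e := Nat.one_lt_pow (by omega) hp.one_lt
  omega

/-- **`a_ν(p^e) = 0` for `p ∣ M`, `e ≥ 1`** when `ν` vanishes on the ideals not coprime to `(M)`.
[folklore] -/
theorem twistCount_prime_pow_eq_zero_of_dvd {M : ℕ}
    (hνM : ∀ I : Ideal (𝓞 K), ¬ IsCoprime I (Ideal.span {(M : 𝓞 K)}) → ν I = 0)
    {p e : ℕ} (hp : p.Prime) (he : 1 ≤ e) (hpM : p ∣ M) : twistCount K ν (p ^ e) = 0 := by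
  rw [twistCount]
  refine Finset.sum_eq_zero fun I hI ↦ hνM I ?_
  exact not_isCoprime_span_of_absNorm_eq K hp he hpM (mem_idealsOfNorm.mp hI)

/-- **The local factor at `p ∣ M` is `1`**: `Σ_e a_ν(p^e)(p^e)^{-s} = 1` when `ν` vanishes on the
ideals not coprime to `(M)`. [folklore] -/
theorem tsum_term_twistCount_prime_pow_eq_one {M : ℕ}
    (hνM : ∀ I : Ideal (𝓞 K), ¬ IsCoprime I (Ideal.span {(M : 𝓞 K)}) → ν I = 0)
    {p : ℕ} (hp : p.Prime) (hpM : p ∣ M) (s : ℂ) :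
    ∑' e : ℕ, LSeries.term (twistCount K ν) s (p ^ e) = 1 := by
  rw [tsum_eq_single 0]
  · rw [pow_zero, LSeries.term_of_ne_zero one_ne_zero, twistCount_one]; simp
  · intro e he
    rw [LSeries.term_of_ne_zero (pow_ne_zero e hp.ne_zero),
      twistCount_prime_pow_eq_zero_of_dvd K ν hνM hp (Nat.one_le_iff_ne_zero.mpr he) hpM, zero_div]

end Summit.ABC.ABC.Theorems.PeterssonJ0

namespace Summit.ABC.ABC.Theorems

/-- **Registered sub-goal `stub_j0_euler` of stub `stub_j0`** (crux stmt-ABC-10870): multiplicativity of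
the Dirichlet coefficients `a_ν(n) = Σ_{N(I)=n} ν(I)` on coprime arguments, the input of the Euler
product of `L(s, ν)` over the rational primes. [folklore] -/
theorem stub_j0_euler : ∀ (K : Type) [Field K] [NumberField K] (ν : Ideal (NumberField.RingOfIntegers K) →*₀ ℂ) (m n : ℕ), m.Coprime n → Literature.NumberTheory.LFunctions.NumberField.twistCount K ν (m * n) = Literature.NumberTheory.LFunctions.NumberField.twistCount K ν m * Literature.NumberTheory.LFunctions.NumberField.twistCount K ν n :=
  fun K _ _ ν _ _ h ↦ PeterssonJ0.twistCount_mul_of_coprime K ν h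

end Summit.ABC.ABC.Theorems

end
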